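/-
Copyright (c) 2026. All rights reserved.
Released under Apache 2.0 license as described in the file LICENSE.
Authors: abc-iut cell, wave-4 seat abc-iut-w4-d059 (proof-only; row «T54·Rc-INVARIANCE» instantiated at the
coset-graph tower and at the chart of a cofinal Galois tower: the capstones' currency).
-/
import Literature.AnabelianGeometry.SemiGraphs.ArithDecompositionDataRcInvariance
import Literature.AnabelianGeometry.SemiGraphs.ArithThm54CapstonesChart
import HarnessLib

/-!
# [SemiAnbd] Thm 5.4 (i)(ii): independence of the chosen §3 representatives, AT THE COSET-GRAPH TOWER and
# AT THE CHART of a cofinal Galois tower (proof-only)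

Mochizuki, *Semi-graphs of anabelioids*, Publ. RIMS **42** (2006), §5 p. 65 ("well-defined up to
conjugation") and Thm 5.4 (i)(ii) p. 66. [cite: MochizukiSemiAnbd2006, Thm 5.4, p. 66]

PROOF-ONLY sequel to `ArithDecompositionDataRcInvariance.lean` (abc-iut cell, layer L3, sub-DAG
`plan/L3/SUBDAG-SemiAnbd-Thm54.md`, row «T54·Rc-INVARIANCE», seat abc-iut-w4-d059 gen 4).  No definition, no
new named fact.  The generic theorems of that file (binders = the (AI3) tree-system currency) are INSTANTIATED
exactly as abc-iut-w4-d053's `ArithLevelDataCpt.ofCosetTowerC` instantiates `ofChartEdgeDataC`: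

* `isEdgeLike_decompositionDataOfChart_iff_cosetTower` — at abc-iut-L3-d4's coset-graph tower of a subgroup
  presentation `P` (trees `P.cosetGraph (K j)`, arithmetic actions `P.arithAct hP (K j)`, finite levels
  `P.cosetGraph (L j)`), the dictionaries DISCHARGED by `hfixN/hstabN/hedgeN/hedgeFixN_of_cosetTower`
  (ArithDictionariesOfCosetTower.lean); binders: those of `ArithLevelDataCpt.ofCosetTowerC` minus the topology,
  `w₀`, `hKopen`, `noSwitchBase` and `stabBranchPairAug` (the outer action enters only through `hP`, for an
  arbitrary `σ : E →* Aut 𝔾`).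
* `isEdgeLike_decompositionDataOfChart_iff_chart`, `arithMaximalCompactStatementI_iff_chart`,
  `arithMaximalCompactStatementII_iff_chart` — at `E := π₁^temp(𝒢) ⋊^out Π_A` over the chart `D.chart` of an
  ARBITRARY cofinal Galois tower `D`, with `P := D.piPresentation`, tree levels `ker (D.projAut n)`, finite
  levels `ker (D.piLevelAut n)` and every tower input a TERM (abc-iut-L3-d4 / abc-iut-L3-t9 / abc-iut-w4-d053:
  `piPresentation_hT/_hHK/_hMK/_hlift/_hliftE/_hfree`, `ker_projAut_le_ker_piLevelAut`,
  `finite_quotient_ker_piLevelAut`, `piPresentation_M_mem_edgeLikeSubgroups_chart`,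
  `range_decompHom_mem_verticialSubgroups_chart`, `outerAction_exact`) — the binder list is that of abc-iut-w4-d029's
  capstone `arithMaximalCompactStatementI_outerAction_piPresentation_chart` restricted to
  {`h37`, `hG`, finiteness, `ρ'`, `baseAct`, `T`, `R`, `hP`, `hKst`, `hLst`, `hnobpNCpt`}, plus the two
  choices `Rc`, `Rc'`.

USE (the L3 lead's α101 brick): the capstones / the integrated theorem of record conclude
`ArithMaximalCompactStatementI/II (decompositionDataOfChart Rc ι) aug` for the representatives `Rc` MATCHED to
the presentation (`hRcV`/`hRcB`, the only ones at which the (AI4″) producer `stabBranchPairAug_chart_outerAction`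
runs); by `arithMaximalCompactStatementI/II_iff_chart` the same statements then hold for EVERY compatible choice
`Rc'`.  Nothing beyond composition is proved here; typed ≠ proved for the capstones' residual inputs; no side
taken on [IUTchIII] Cor. 3.12.
-/

namespace Literature.AnabelianGeometry.SemiGraphs

namespace ProfiniteSemiGraph

open CategoryTheory
open Literature.AnabelianGeometry.EtaleTheta
open scoped Pointwise

universe u v w

/-! ### At the coset-graph tower of a subgroup presentation -/

section CosetTower

variable {𝒢 : ProfiniteSemiGraph.{u}} (c : TemperedPiChart 𝒢)

/-- **"Edge-like" for the chart-produced data does not depend on the representatives — at the coset-graph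
tower.**  `isEdgeLike_decompositionDataOfChart_iff_of_chartRepresentatives` with trees `P.cosetGraph (K j)`,
arithmetic actions `P.arithAct hP (K j)`, transitions `P.cosetGraphTrans`, finite levels `P.cosetGraph (L j)`,
and the two-sided dictionaries DISCHARGED by abc-iut-w4-d053's `hfixN/hstabN/hedgeN/hedgeFixN_of_cosetTower`.
[cite: MochizukiSemiAnbd2006, Def 5.3 (iii), p. 65] -/
theorem isEdgeLike_decompositionDataOfChart_iff_cosetTower
    (h𝒢 : 𝒢.Thm37Hypotheses) (hG : 𝒢.graph.IsGraph) [Finite 𝒢.graph.Vertex] [Finite 𝒢.graph.Branch]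
    {E : Type w} [Group E] (ι : c.G →* E) (hι : Function.Injective ι) (hnorm : (ι.range).Normal)
    (P : SemiGraph.SubgroupPresentation 𝒢.graph c.G) {Φ : E →* MulAut c.G} {σ : E →* Aut 𝒢.graph}
    (hP : P.IsArithCompatible Φ σ)
    (hιΦ : ∀ g : c.G, Φ (ι g) = MulAut.conj g) (hισ : ∀ g : c.G, σ (ι g) = 1)
    (hPH : ∀ w, P.H w ∈ verticialSubgroups c w) (hPM : ∀ e, P.M e ∈ edgeLikeSubgroups c e)
    -- the tree levels
    (K : ℕ → Subgroup c.G) [∀ j, (K j).Normal] (hK : ∀ ⦃i j : ℕ⦄, i ≤ j → K j ≤ K i)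
    (hKst : ∀ (j : ℕ) (e : E) (x : c.G), x ∈ K j → Φ e x ∈ K j)
    (hT : ∀ j, (P.cosetGraph (K j)).IsTree)
    -- dict2's algebraic tower inputs
    (hHK : ∀ (w : 𝒢.graph.Vertex) (x : c.G), (∀ j, x ∈ (P.H w : Set c.G) * (K j : Set c.G)) → x ∈ P.H w)
    (hMK : ∀ (e : 𝒢.graph.Edge) (x : c.G), (∀ j, x ∈ (P.M e : Set c.G) * (K j : Set c.G)) → x ∈ P.M e)
    (hlift : ∀ (w : 𝒢.graph.Vertex) (y : ℕ → c.G),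
      (∀ ⦃i j : ℕ⦄, i ≤ j →
        DoubleCoset.mk (P.H w) (K i) (y j) = DoubleCoset.mk (P.H w) (K i) (y i)) →
      ∃ z : c.G, ∀ j, DoubleCoset.mk (P.H w) (K j) z = DoubleCoset.mk (P.H w) (K j) (y j))
    (hliftE : ∀ (j₁ : ℕ) (e : 𝒢.graph.Edge) (y : {j : ℕ // j₁ ≤ j} → c.G),
      (∀ ⦃i j : {j : ℕ // j₁ ≤ j}⦄, i.1 ≤ j.1 →
        DoubleCoset.mk (P.M e) (K i.1) (y j) = DoubleCoset.mk (P.M e) (K i.1) (y i)) →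
      ∃ z : c.G, ∀ j, DoubleCoset.mk (P.M e) (K j.1) z = DoubleCoset.mk (P.M e) (K j.1) (y j))
    -- the finite levels
    (L : ℕ → Subgroup c.G) [∀ j, (L j).Normal] [∀ j, Finite (c.G ⧸ L j)]
    (hL : ∀ ⦃i j : ℕ⦄, i ≤ j → L j ≤ L i)
    (hLst : ∀ (j : ℕ) (e : E) (x : c.G), x ∈ L j → Φ e x ∈ L j) (hKL : ∀ j, K j ≤ L j)
    (hfree : ∀ (j : ℕ) (w : 𝒢.graph.Vertex) (z x : c.G), x ∈ L j → z * x * z⁻¹ ∈ P.H w → x ∈ K j)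
    -- the estrangement consequence at the finite levels, compact subgroups only
    (hnobpNCpt : ∀ (C : Subgroup c.G), IsCompact (C : Set c.G) →
      ∀ (j₀ : ℕ) (w : ∀ i : {i : ℕ // j₀ ≤ i}, (P.cosetGraph (L i.1)).Vertex)
      (β β' : ∀ i : {i : ℕ // j₀ ≤ i}, (P.cosetGraph (L i.1)).Branch),
      (∀ i, β i ≠ β' i ∧ (P.cosetGraph (L i.1)).abuts (β i) = some (w i) ∧
        (P.cosetGraph (L i.1)).abuts (β' i) = some (w i)) →
      (∀ ⦃i i' : {i : ℕ // j₀ ≤ i}⦄ (h : i.1 ≤ i'.1), (P.cosetGraphTrans (hL h)).vertexMap (w i') = w i ∧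
        (P.cosetGraphTrans (hL h)).branchMap (β i') = β i ∧
          (P.cosetGraphTrans (hL h)).branchMap (β' i') = β' i) →
      (∀ (i : {i : ℕ // j₀ ≤ i}) (γ : C), (P.arithAct hP (L i.1) (hLst i.1) (ι γ)).hom.vertexMap (w i) = w i ∧
        (P.arithAct hP (L i.1) (hLst i.1) (ι γ)).hom.branchMap (β i) = β i ∧
          (P.arithAct hP (L i.1) (hLst i.1) (ι γ)).hom.branchMap (β' i) = β' i) → C = ⊥)
    (R R' : ChartRepresentatives c) (S : Subgroup E) :
    IsEdgeLike (decompositionDataOfChart R ι) S ↔ IsEdgeLike (decompositionDataOfChart R' ι) S :=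
  haveI : ∀ j, Finite (P.cosetGraph (L j)).Vertex := fun j => P.finite_cosetGraph_vertex (L j)
  haveI : ∀ j, Finite (P.cosetGraph (L j)).Branch := fun j => P.finite_cosetGraph_branch (L j)
  isEdgeLike_decompositionDataOfChart_iff_of_chartRepresentatives ι
    (T := fun j => P.cosetGraph (K j)) (ρ := fun j => P.arithAct hP (K j) (hKst j))
    (f := fun _ _ h => P.cosetGraphTrans (hK h))
    (level := fun j => P.cosetGraph (L j)) (levelAct := fun j => P.arithAct hP (L j) (hLst j))
    (quot := fun j => P.cosetGraphTrans (hKL j)) (levelTrans := fun _ _ h => P.cosetGraphTrans (hL h))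
    h𝒢 hι hnorm hT
    (fun j => P.cosetGraphTrans_refl (K j))
    (fun _ _ _ hij hjk => P.cosetGraphTrans_comp (hK hjk) (hK hij))
    (fun _ _ h g => P.arithAct_trans hP (hKst _) (hKst _) (hK h) g)
    (fun j => P.cosetGraphTrans_isImmersion (hKL j) (hfree j))
    (fun j g => P.arithAct_trans hP (hKst j) (hLst j) (hKL j) g)
    (fun j => P.cosetGraphTrans_refl (L j))
    (fun _ _ _ hij hjk => P.cosetGraphTrans_comp (hL hjk) (hL hij))
    (fun _ _ h g => P.arithAct_trans hP (hLst _) (hLst _) (hL h) g)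
    (fun _ _ h => by rw [P.cosetGraphTrans_comp, P.cosetGraphTrans_comp])
    hnobpNCpt
    (hfixN_of_cosetTower c P hP ι hιΦ hισ K hK hKst hPH hHK)
    (hstabN_of_cosetTower c P hP ι hιΦ hισ K hK hKst hPH hHK hlift)
    (hedgeN_of_cosetTower c P hP ι hιΦ hισ K hK hKst hPM hMK hliftE)
    (hedgeFixN_of_cosetTower c P hP ι hιΦ hισ K hK hKst hPM hMK hT hG) R R' S

end CosetTower

/-! ### At the chart of a cofinal Galois tower (the capstones' currency) -/

section Chart

variable {𝒢 : ProfiniteSemiGraph.{u}} (D : GaloisLevelData 𝒢) (h𝒢 : 𝒢.IsCountable)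
  (hcof : ∀ (T : CovObj 𝒢), T.IsTempered → ∀ p : T.Point,
    ∃ i : ℕ, ∀ j, i ≤ j → (D.S j).Splits (T.component p))
  (hcn : 𝒢.graph.IsConnected) (hS : ∀ n, (D.S n).Splits (D.S n)) (hfin : ∀ n, (D.S n).IsFinite)
  (hne : ∀ n, (D.S n).HasNonemptyFibres)
  (hconn : ∀ (n : ℕ) (p q : (D.S n).Point), (D.S n).SameComponent p q)

/-- **"Edge-like" for the chart-produced data at `π₁^temp(𝒢) ⋊^out Π_A` does not depend on the
representatives** — the chart of an ARBITRARY cofinal Galois tower `D`, every tower input a term (as in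
abc-iut-w4-d029's capstone `arithMaximalCompactStatementI_outerAction_piPresentation_chart`).
[cite: MochizukiSemiAnbd2006, Def 5.3 (iii), p. 65] -/
theorem isEdgeLike_decompositionDataOfChart_iff_chart
    (h37 : 𝒢.Thm37Hypotheses) (hG : 𝒢.graph.IsGraph) [Finite 𝒢.graph.Vertex] [Finite 𝒢.graph.Branch]
    {PA : Type u} [Group PA]
    (ρ' : PA →* TopOut (D.chart h𝒢 hcof hcn hS hfin hne).G) (baseAct : PA →* Aut 𝒢.graph)
    (T : ∀ w : 𝒢.graph.Vertex, D.PointSeq h𝒢 w) (R : SemiGraph.RefBranches 𝒢.graph)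
    (hP : (D.piPresentation h𝒢 T R).IsArithCompatible (((contMulAut (D.chart h𝒢 hcof hcn hS hfin hne).G).subtype.comp (MonoidHom.fst (contMulAut (D.chart h𝒢 hcof hcn hS hfin hne).G) PA)).comp (outerSemidirectProduct ρ').subtype) (baseAct.comp (outerSemidirectProductSnd ρ')))
    (hKst : ∀ (n : ℕ) (e : outerSemidirectProduct ρ') (x : (D.chart h𝒢 hcof hcn hS hfin hne).G), x ∈ (D.projAut h𝒢 n).ker → (((contMulAut (D.chart h𝒢 hcof hcn hS hfin hne).G).subtype.comp (MonoidHom.fst (contMulAut (D.chart h𝒢 hcof hcn hS hfin hne).G) PA)).comp (outerSemidirectProduct ρ').subtype) e x ∈ (D.projAut h𝒢 n).ker)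
    (hLst : ∀ (n : ℕ) (e : outerSemidirectProduct ρ') (x : (D.chart h𝒢 hcof hcn hS hfin hne).G), x ∈ (D.piLevelAut h𝒢 hconn n).ker → (((contMulAut (D.chart h𝒢 hcof hcn hS hfin hne).G).subtype.comp (MonoidHom.fst (contMulAut (D.chart h𝒢 hcof hcn hS hfin hne).G) PA)).comp (outerSemidirectProduct ρ').subtype) e x ∈ (D.piLevelAut h𝒢 hconn n).ker)
    (hnobpNCpt : ∀ (C : Subgroup (D.chart h𝒢 hcof hcn hS hfin hne).G), IsCompact (C : Set (D.chart h𝒢 hcof hcn hS hfin hne).G) →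
      ∀ (j₀ : ℕ) (w : ∀ i : {i : ℕ // j₀ ≤ i}, ((D.piPresentation h𝒢 T R).cosetGraph (D.piLevelAut h𝒢 hconn i.1).ker).Vertex)
      (β β' : ∀ i : {i : ℕ // j₀ ≤ i}, ((D.piPresentation h𝒢 T R).cosetGraph (D.piLevelAut h𝒢 hconn i.1).ker).Branch),
      (∀ i, β i ≠ β' i ∧ ((D.piPresentation h𝒢 T R).cosetGraph (D.piLevelAut h𝒢 hconn i.1).ker).abuts (β i) = some (w i) ∧
        ((D.piPresentation h𝒢 T R).cosetGraph (D.piLevelAut h𝒢 hconn i.1).ker).abuts (β' i) = some (w i)) →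
      (∀ ⦃i i' : {i : ℕ // j₀ ≤ i}⦄ (h : i.1 ≤ i'.1),
        ((D.piPresentation h𝒢 T R).cosetGraphTrans (D.ker_piLevelAut_anti h𝒢 hconn h)).vertexMap (w i') = w i ∧
        ((D.piPresentation h𝒢 T R).cosetGraphTrans (D.ker_piLevelAut_anti h𝒢 hconn h)).branchMap (β i') = β i ∧
          ((D.piPresentation h𝒢 T R).cosetGraphTrans (D.ker_piLevelAut_anti h𝒢 hconn h)).branchMap (β' i') = β' i) →
      (∀ (i : {i : ℕ // j₀ ≤ i}) (γ : C),
        ((D.piPresentation h𝒢 T R).arithAct hP (D.piLevelAut h𝒢 hconn i.1).ker (hLst i.1) ((toOuterSemidirectProduct ρ') γ)).hom.vertexMap (w i) = w i ∧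
        ((D.piPresentation h𝒢 T R).arithAct hP (D.piLevelAut h𝒢 hconn i.1).ker (hLst i.1) ((toOuterSemidirectProduct ρ') γ)).hom.branchMap (β i) = β i ∧
          ((D.piPresentation h𝒢 T R).arithAct hP (D.piLevelAut h𝒢 hconn i.1).ker (hLst i.1) ((toOuterSemidirectProduct ρ') γ)).hom.branchMap (β' i) = β' i) → C = ⊥)
    (Rc Rc' : ChartRepresentatives (D.chart h𝒢 hcof hcn hS hfin hne)) (S : Subgroup (outerSemidirectProduct ρ')) :
    IsEdgeLike (decompositionDataOfChart Rc (toOuterSemidirectProduct ρ')) S ↔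
      IsEdgeLike (decompositionDataOfChart Rc' (toOuterSemidirectProduct ρ')) S := by
  -- exactness of `1 → π₁^temp → E → Π_A → 1` (temp-slimness)
  obtain ⟨hι, hex, -⟩ := outerAction_exact (D.chart h𝒢 hcof hcn hS hfin hne) ρ' h37.toProp36Hypotheses
  have hnorm : ((toOuterSemidirectProduct ρ').range).Normal := by rw [hex]; infer_instance
  have hιΦ : ∀ g : (D.chart h𝒢 hcof hcn hS hfin hne).G, (((contMulAut (D.chart h𝒢 hcof hcn hS hfin hne).G).subtype.comp (MonoidHom.fst (contMulAut (D.chart h𝒢 hcof hcn hS hfin hne).G) PA)).comp (outerSemidirectProduct ρ').subtype) ((toOuterSemidirectProduct ρ') g) = MulAut.conj g := fun _ => rfl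
  have hισ : ∀ g : (D.chart h𝒢 hcof hcn hS hfin hne).G, (baseAct.comp (outerSemidirectProductSnd ρ')) ((toOuterSemidirectProduct ρ') g) = 1 := fun g => by
    have hg : (toOuterSemidirectProduct ρ') g ∈ (outerSemidirectProductSnd ρ').ker := hex ▸ ⟨g, rfl⟩
    rw [MonoidHom.comp_apply, (MonoidHom.mem_ker).mp hg, map_one]
  have hPH : ∀ w, (D.piPresentation h𝒢 T R).H w ∈ verticialSubgroups (D.chart h𝒢 hcof hcn hS hfin hne) w := fun w => by
    rw [D.piPresentation_H h𝒢 T R]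
    exact (T w).range_decompHom_mem_verticialSubgroups_chart hcof hcn hS hfin hne
  -- instantiate at the coset-graph tower of `D.piPresentation` (instances passed explicitly, as in
  -- abc-iut-w4-d029's capstone: the kernel levels are normal, the finite levels have finite index)
  exact @isEdgeLike_decompositionDataOfChart_iff_cosetTower 𝒢 (D.chart h𝒢 hcof hcn hS hfin hne) h37 hG _ _
    (outerSemidirectProduct ρ') _ (toOuterSemidirectProduct ρ') hι hnorm (D.piPresentation h𝒢 T R) _ _ hP hιΦ hισ hPH
    (fun ε => piPresentation_M_mem_edgeLikeSubgroups_chart D h𝒢 hcof hcn hS hfin hne T R ε)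
    (fun n => (D.projAut h𝒢 n).ker) (fun _ => MonoidHom.normal_ker _) (D.ker_projAut_anti h𝒢)
    hKst (D.piPresentation_hT h𝒢 T R)
    (D.piPresentation_hHK h𝒢 T R) (D.piPresentation_hMK h𝒢 T R)
    (D.piPresentation_hlift h𝒢 T R) (D.piPresentation_hliftE h𝒢 T R)
    (fun n => (D.piLevelAut h𝒢 hconn n).ker) (fun _ => MonoidHom.normal_ker _)
    (fun j => D.finite_quotient_ker_piLevelAut h𝒢 hconn hfin j)
    (D.ker_piLevelAut_anti h𝒢 hconn) hLst
    (fun n => D.ker_projAut_le_ker_piLevelAut h𝒢 hconn n) (D.piPresentation_hfree h𝒢 hconn T R)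
    hnobpNCpt Rc Rc' S

/-- **[SemiAnbd] Thm 5.4 (i) at `π₁^temp(𝒢) ⋊^out Π_A` does not depend on the chosen representatives**:
`ArithMaximalCompactStatementI` for `decompositionDataOfChart Rc` iff for `decompositionDataOfChart Rc'` — so the
capstone's conclusion at the MATCHED representatives (`hRcV`/`hRcB`) holds for every compatible choice.
[cite: MochizukiSemiAnbd2006, Thm 5.4 (i), p. 66] -/
theorem arithMaximalCompactStatementI_iff_chart
    (h37 : 𝒢.Thm37Hypotheses) (hG : 𝒢.graph.IsGraph) [Finite 𝒢.graph.Vertex] [Finite 𝒢.graph.Branch]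
    {PA : Type u} [Group PA] [TopologicalSpace PA]
    (ρ' : PA →* TopOut (D.chart h𝒢 hcof hcn hS hfin hne).G) (baseAct : PA →* Aut 𝒢.graph)
    [TopologicalSpace (outerSemidirectProduct ρ')]
    (T : ∀ w : 𝒢.graph.Vertex, D.PointSeq h𝒢 w) (R : SemiGraph.RefBranches 𝒢.graph)
    (hP : (D.piPresentation h𝒢 T R).IsArithCompatible (((contMulAut (D.chart h𝒢 hcof hcn hS hfin hne).G).subtype.comp (MonoidHom.fst (contMulAut (D.chart h𝒢 hcof hcn hS hfin hne).G) PA)).comp (outerSemidirectProduct ρ').subtype) (baseAct.comp (outerSemidirectProductSnd ρ')))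
    (hKst : ∀ (n : ℕ) (e : outerSemidirectProduct ρ') (x : (D.chart h𝒢 hcof hcn hS hfin hne).G), x ∈ (D.projAut h𝒢 n).ker → (((contMulAut (D.chart h𝒢 hcof hcn hS hfin hne).G).subtype.comp (MonoidHom.fst (contMulAut (D.chart h𝒢 hcof hcn hS hfin hne).G) PA)).comp (outerSemidirectProduct ρ').subtype) e x ∈ (D.projAut h𝒢 n).ker)
    (hLst : ∀ (n : ℕ) (e : outerSemidirectProduct ρ') (x : (D.chart h𝒢 hcof hcn hS hfin hne).G), x ∈ (D.piLevelAut h𝒢 hconn n).ker → (((contMulAut (D.chart h𝒢 hcof hcn hS hfin hne).G).subtype.comp (MonoidHom.fst (contMulAut (D.chart h𝒢 hcof hcn hS hfin hne).G) PA)).comp (outerSemidirectProduct ρ').subtype) e x ∈ (D.piLevelAut h𝒢 hconn n).ker)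
    (hnobpNCpt : ∀ (C : Subgroup (D.chart h𝒢 hcof hcn hS hfin hne).G), IsCompact (C : Set (D.chart h𝒢 hcof hcn hS hfin hne).G) →
      ∀ (j₀ : ℕ) (w : ∀ i : {i : ℕ // j₀ ≤ i}, ((D.piPresentation h𝒢 T R).cosetGraph (D.piLevelAut h𝒢 hconn i.1).ker).Vertex)
      (β β' : ∀ i : {i : ℕ // j₀ ≤ i}, ((D.piPresentation h𝒢 T R).cosetGraph (D.piLevelAut h𝒢 hconn i.1).ker).Branch),
      (∀ i, β i ≠ β' i ∧ ((D.piPresentation h𝒢 T R).cosetGraph (D.piLevelAut h𝒢 hconn i.1).ker).abuts (β i) = some (w i) ∧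
        ((D.piPresentation h𝒢 T R).cosetGraph (D.piLevelAut h𝒢 hconn i.1).ker).abuts (β' i) = some (w i)) →
      (∀ ⦃i i' : {i : ℕ // j₀ ≤ i}⦄ (h : i.1 ≤ i'.1),
        ((D.piPresentation h𝒢 T R).cosetGraphTrans (D.ker_piLevelAut_anti h𝒢 hconn h)).vertexMap (w i') = w i ∧
        ((D.piPresentation h𝒢 T R).cosetGraphTrans (D.ker_piLevelAut_anti h𝒢 hconn h)).branchMap (β i') = β i ∧
          ((D.piPresentation h𝒢 T R).cosetGraphTrans (D.ker_piLevelAut_anti h𝒢 hconn h)).branchMap (β' i') = β' i) →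
      (∀ (i : {i : ℕ // j₀ ≤ i}) (γ : C),
        ((D.piPresentation h𝒢 T R).arithAct hP (D.piLevelAut h𝒢 hconn i.1).ker (hLst i.1) ((toOuterSemidirectProduct ρ') γ)).hom.vertexMap (w i) = w i ∧
        ((D.piPresentation h𝒢 T R).arithAct hP (D.piLevelAut h𝒢 hconn i.1).ker (hLst i.1) ((toOuterSemidirectProduct ρ') γ)).hom.branchMap (β i) = β i ∧
          ((D.piPresentation h𝒢 T R).arithAct hP (D.piLevelAut h𝒢 hconn i.1).ker (hLst i.1) ((toOuterSemidirectProduct ρ') γ)).hom.branchMap (β' i) = β' i) → C = ⊥)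
    (Rc Rc' : ChartRepresentatives (D.chart h𝒢 hcof hcn hS hfin hne)) :
    ArithMaximalCompactStatementI (decompositionDataOfChart Rc (toOuterSemidirectProduct ρ')) (outerSemidirectProductSnd ρ') ↔
      ArithMaximalCompactStatementI (decompositionDataOfChart Rc' (toOuterSemidirectProduct ρ')) (outerSemidirectProductSnd ρ') :=
  arithMaximalCompactStatementI_iff_of_isVerticial_iff_of_isEdgeLike_iff (outerSemidirectProductSnd ρ')
    (isVerticial_decompositionDataOfChart_iff_of_chartRepresentatives (toOuterSemidirectProduct ρ') Rc Rc')
    (isEdgeLike_decompositionDataOfChart_iff_chart D h𝒢 hcof hcn hS hfin hne hconn h37 hG ρ' baseAct T R hP hKst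
      hLst hnobpNCpt Rc Rc')

/-- **[SemiAnbd] Thm 5.4 (ii) at `π₁^temp(𝒢) ⋊^out Π_A` does not depend on the chosen representatives** — as
for (i). [cite: MochizukiSemiAnbd2006, Thm 5.4 (ii), p. 66] -/
theorem arithMaximalCompactStatementII_iff_chart
    (h37 : 𝒢.Thm37Hypotheses) (hG : 𝒢.graph.IsGraph) [Finite 𝒢.graph.Vertex] [Finite 𝒢.graph.Branch]
    {PA : Type u} [Group PA] [TopologicalSpace PA]
    (ρ' : PA →* TopOut (D.chart h𝒢 hcof hcn hS hfin hne).G) (baseAct : PA →* Aut 𝒢.graph)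
    [TopologicalSpace (outerSemidirectProduct ρ')]
    (T : ∀ w : 𝒢.graph.Vertex, D.PointSeq h𝒢 w) (R : SemiGraph.RefBranches 𝒢.graph)
    (hP : (D.piPresentation h𝒢 T R).IsArithCompatible (((contMulAut (D.chart h𝒢 hcof hcn hS hfin hne).G).subtype.comp (MonoidHom.fst (contMulAut (D.chart h𝒢 hcof hcn hS hfin hne).G) PA)).comp (outerSemidirectProduct ρ').subtype) (baseAct.comp (outerSemidirectProductSnd ρ')))
    (hKst : ∀ (n : ℕ) (e : outerSemidirectProduct ρ') (x : (D.chart h𝒢 hcof hcn hS hfin hne).G), x ∈ (D.projAut h𝒢 n).ker → (((contMulAut (D.chart h𝒢 hcof hcn hS hfin hne).G).subtype.comp (MonoidHom.fst (contMulAut (D.chart h𝒢 hcof hcn hS hfin hne).G) PA)).comp (outerSemidirectProduct ρ').subtype) e x ∈ (D.projAut h𝒢 n).ker)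
    (hLst : ∀ (n : ℕ) (e : outerSemidirectProduct ρ') (x : (D.chart h𝒢 hcof hcn hS hfin hne).G), x ∈ (D.piLevelAut h𝒢 hconn n).ker → (((contMulAut (D.chart h𝒢 hcof hcn hS hfin hne).G).subtype.comp (MonoidHom.fst (contMulAut (D.chart h𝒢 hcof hcn hS hfin hne).G) PA)).comp (outerSemidirectProduct ρ').subtype) e x ∈ (D.piLevelAut h𝒢 hconn n).ker)
    (hnobpNCpt : ∀ (C : Subgroup (D.chart h𝒢 hcof hcn hS hfin hne).G), IsCompact (C : Set (D.chart h𝒢 hcof hcn hS hfin hne).G) →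
      ∀ (j₀ : ℕ) (w : ∀ i : {i : ℕ // j₀ ≤ i}, ((D.piPresentation h𝒢 T R).cosetGraph (D.piLevelAut h𝒢 hconn i.1).ker).Vertex)
      (β β' : ∀ i : {i : ℕ // j₀ ≤ i}, ((D.piPresentation h𝒢 T R).cosetGraph (D.piLevelAut h𝒢 hconn i.1).ker).Branch),
      (∀ i, β i ≠ β' i ∧ ((D.piPresentation h𝒢 T R).cosetGraph (D.piLevelAut h𝒢 hconn i.1).ker).abuts (β i) = some (w i) ∧
        ((D.piPresentation h𝒢 T R).cosetGraph (D.piLevelAut h𝒢 hconn i.1).ker).abuts (β' i) = some (w i)) →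
      (∀ ⦃i i' : {i : ℕ // j₀ ≤ i}⦄ (h : i.1 ≤ i'.1),
        ((D.piPresentation h𝒢 T R).cosetGraphTrans (D.ker_piLevelAut_anti h𝒢 hconn h)).vertexMap (w i') = w i ∧
        ((D.piPresentation h𝒢 T R).cosetGraphTrans (D.ker_piLevelAut_anti h𝒢 hconn h)).branchMap (β i') = β i ∧
          ((D.piPresentation h𝒢 T R).cosetGraphTrans (D.ker_piLevelAut_anti h𝒢 hconn h)).branchMap (β' i') = β' i) →
      (∀ (i : {i : ℕ // j₀ ≤ i}) (γ : C),
        ((D.piPresentation h𝒢 T R).arithAct hP (D.piLevelAut h𝒢 hconn i.1).ker (hLst i.1) ((toOuterSemidirectProduct ρ') γ)).hom.vertexMap (w i) = w i ∧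
        ((D.piPresentation h𝒢 T R).arithAct hP (D.piLevelAut h𝒢 hconn i.1).ker (hLst i.1) ((toOuterSemidirectProduct ρ') γ)).hom.branchMap (β i) = β i ∧
          ((D.piPresentation h𝒢 T R).arithAct hP (D.piLevelAut h𝒢 hconn i.1).ker (hLst i.1) ((toOuterSemidirectProduct ρ') γ)).hom.branchMap (β' i) = β' i) → C = ⊥)
    (Rc Rc' : ChartRepresentatives (D.chart h𝒢 hcof hcn hS hfin hne)) :
    ArithMaximalCompactStatementII (decompositionDataOfChart Rc (toOuterSemidirectProduct ρ')) (outerSemidirectProductSnd ρ') ↔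
      ArithMaximalCompactStatementII (decompositionDataOfChart Rc' (toOuterSemidirectProduct ρ')) (outerSemidirectProductSnd ρ') :=
  arithMaximalCompactStatementII_iff_of_isVerticial_iff_of_isEdgeLike_iff (outerSemidirectProductSnd ρ')
    (isVerticial_decompositionDataOfChart_iff_of_chartRepresentatives (toOuterSemidirectProduct ρ') Rc Rc')
    (isEdgeLike_decompositionDataOfChart_iff_chart D h𝒢 hcof hcn hS hfin hne hconn h37 hG ρ' baseAct T R hP hKst
      hLst hnobpNCpt Rc Rc')

end Chart

end ProfiniteSemiGraph

end Literature.AnabelianGeometry.SemiGraphs
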